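import Summits.QuantumFields.YangMills.Theorems.CurvatureBoostCovariance.Negative.BetaZeroMoments
import Literature.MathematicalPhysics.QuantumFieldTheory.ConstructiveQFTWave0OddRPProofs

/-!
# `HypercubicLimit` — support: the lattice mirror of the curvature, and the plaquette RP square

Support file for crux `stmt-QuantumFields-8646` (`HypercubicLimit`), extracted from the standing disprover's
work file `Cruxes/HypercubicLimit/Disproof.lean` §§11–12 (cycle 3); the objects `torusPlaquette`,
`torusDensity`, `rpSquare` are VERBATIM those of the picked line `Lines/conditional-mean-telescoping.lean`
(namespaced here), so the lead and the closure prover can import the results.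

* `torusPlaquette_timeReflect_temporal` / `_spatial`: under the odd-torus reflection `Θ`
  (`GaugeConfig.timeReflect`, `t ↦ 1 − t`) a spatial plaquette based at `x` goes to the one based at
  `θ_ℤ x`, a TEMPORAL one to the one based at `θ_ℤ x − e₀` (it hangs down).
* `torusDensity_timeReflect`: `P_x ∘ Θ = P̃_{θ_ℤ x}` with the REFLECTED density `reflDensity` (temporal
  plaquettes below the site); `reflDensity_sub_torusDensity`: `P̃_y − P_y = −∑ⱼ (Eⱼ(y) − Eⱼ(y − e₀))`;
  `sum_mul_reflDensity_sub`: smeared against `w`, the swap is the electric part against the forward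
  difference of `w` — one lattice spacing of a derivative (times the multiplicative renormalisation, when
  renormalised): the lattice OS form pairs the smeared curvature with a DIFFERENT species at the lattice
  scale, which is the obstruction to lattice-RP arguments about the curvature's continuum limit for
  general witnesses and the estimate owed for E2 of a limit.
* `rpSquare_nonneg`: the reference quantity `A(β,S,R) = ⟨θX·X⟩`, `X = δp₀₁(R e₀)`, is a genuine
  Osterwalder–Seiler square: `0 ≤ A` for `β ≥ 0`, `1 ≤ R ≤ S` (the four links of `p₀₁(R e₀)` lie in
  `P ∪ M` of `wilsonExpectation_oddReflectionPositive`). [folklore]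
-/

noncomputable section

open scoped ComplexConjugate
open MeasureTheory Filter Topology
open Literature.Probability.LatticeModels (Torus.proj)
open Literature.MathematicalPhysics.AQFT Literature.MathematicalPhysics.QuantumLattice
open Literature.MathematicalPhysics.QuantumFieldTheory

namespace Summit.QuantumFields.YangMills.Theorems.HypercubicLimit.Negative

section ReflectedDensity

variable {G : Type} [Group G] [TopologicalSpace G] [IsTopologicalGroup G] [CompactSpace G]
  [MeasurableSpace G] [BorelSpace G]

/-- VERBATIM `ConditionalMeanTelescoping.torusPlaquette`: the plaquette `Re tr ρ(U_p)` of orientation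
`(i, j)` based at the `ℤ⁴`-site `x`, on the torus of side `L` (periodic lift). [folklore] -/
def torusPlaquette (r : LatticeRep G) (L : ℕ) (i j : Fin 4) (x : (Fin 4 → ℤ)) (U : GaugeConfig 4 L G) : ℝ :=
  plaquetteObs r.ρ x i j (torusLift L U)

/-- VERBATIM `ConditionalMeanTelescoping.torusDensity`: the curvature species at `x` on the torus. [folklore] -/
def torusDensity (r : LatticeRep G) (L : ℕ) (x : (Fin 4 → ℤ)) (U : GaugeConfig 4 L G) : ℝ :=
  r.curvature.F (configShift (-x) (torusLift L U))

omit [Group G] [TopologicalSpace G] [IsTopologicalGroup G] [CompactSpace G] [MeasurableSpace G]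
  [BorelSpace G] in
/-- `ℤ⁴` time reflection `t ↦ 1 − t` (the lift of `Site.timeReflect`). [folklore] -/
def thetaZ (x : (Fin 4 → ℤ)) : (Fin 4 → ℤ) := Function.update x 0 (1 - x 0)

omit [Group G] [TopologicalSpace G] [IsTopologicalGroup G] [CompactSpace G] [MeasurableSpace G]
  [BorelSpace G] in
/-- `thetaZ_apply_zero` (auxiliary). [folklore] -/
@[simp] theorem thetaZ_apply_zero (x : (Fin 4 → ℤ)) : thetaZ x 0 = 1 - x 0 := by simp [thetaZ]

omit [Group G] [TopologicalSpace G] [IsTopologicalGroup G] [CompactSpace G] [MeasurableSpace G]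
  [BorelSpace G] in
/-- `thetaZ_apply_of_ne` (auxiliary). [folklore] -/
theorem thetaZ_apply_of_ne (x : (Fin 4 → ℤ)) {k : Fin 4} (hk : k ≠ 0) : thetaZ x k = x k := by
  simp [thetaZ, hk]

omit [Group G] [TopologicalSpace G] [IsTopologicalGroup G] [CompactSpace G] [MeasurableSpace G]
  [BorelSpace G] in
/-- `proj ∘ θ_ℤ = θ ∘ proj`. [folklore] -/
theorem proj_thetaZ (L : ℕ) (x : (Fin 4 → ℤ)) :
    Torus.proj L (thetaZ x) =
      Literature.MathematicalPhysics.QuantumFieldTheory.Site.timeReflect (Torus.proj L x) := by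
  ext k
  by_cases hk : k = 0
  · subst hk
    simp [Torus.proj, Literature.MathematicalPhysics.QuantumFieldTheory.Site.timeReflect]
  · simp [Torus.proj, Literature.MathematicalPhysics.QuantumFieldTheory.Site.timeReflect, hk, thetaZ]

omit [Group G] [TopologicalSpace G] [IsTopologicalGroup G] [CompactSpace G] [MeasurableSpace G]
  [BorelSpace G] in
/-- The reflected base point of a temporal plaquette: `θ(x̄ + e₀) = proj (θ_ℤ x − e₀)`. [folklore] -/
theorem timeReflect_shift_proj (L : ℕ) (x : (Fin 4 → ℤ)) :
    Literature.MathematicalPhysics.QuantumFieldTheory.Site.timeReflect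
        (Literature.MathematicalPhysics.QuantumFieldTheory.Site.shift (Torus.proj L x) 0) =
      Torus.proj L (thetaZ x - Pi.single 0 1) := by
  ext k
  by_cases hk : k = 0
  · subst hk
    simp [Torus.proj, Literature.MathematicalPhysics.QuantumFieldTheory.Site.timeReflect,
      Literature.MathematicalPhysics.QuantumFieldTheory.Site.shift]
  · simp [Torus.proj, Literature.MathematicalPhysics.QuantumFieldTheory.Site.timeReflect,
      Literature.MathematicalPhysics.QuantumFieldTheory.Site.shift, hk, thetaZ]

omit [IsTopologicalGroup G] [CompactSpace G] [MeasurableSpace G] [BorelSpace G] in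
/-- The torus plaquette is the tree's `plaqRe` at the projected base point. [folklore] -/
theorem torusPlaquette_eq_plaqRe (r : LatticeRep G) (L : ℕ) {i j : Fin 4} (hij : i < j) (x : (Fin 4 → ℤ))
    (U : GaugeConfig 4 L G) :
    torusPlaquette r L i j x U = WilsonRP.plaqRe r.ρ U (Torus.proj L x, ⟨(i, j), hij⟩) := by
  unfold torusPlaquette WilsonRP.plaqRe plaquetteObs
  rw [CurvatureBoostCovariance.Negative.plaquetteHolonomyZd_torusLift']

omit [MeasurableSpace G] [BorelSpace G] in
/-- **Temporal plaquettes hang down after reflection**: `p_{0j}(x) ∘ Θ = p_{0j}(θ_ℤ x − e₀)`. [folklore] -/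
theorem torusPlaquette_timeReflect_temporal (r : LatticeRep G) (L : ℕ) {j : Fin 4} (hj : 0 < j)
    (x : (Fin 4 → ℤ)) (U : GaugeConfig 4 L G) :
    torusPlaquette r L 0 j x U.timeReflect = torusPlaquette r L 0 j (thetaZ x - Pi.single 0 1) U := by
  rw [torusPlaquette_eq_plaqRe r L hj, torusPlaquette_eq_plaqRe r L hj,
    WilsonRP.plaqRe_timeReflect r.ρ r.continuous]
  simp only [WilsonRP.plaqReflect, ↓reduceIte, timeReflect_shift_proj]

omit [MeasurableSpace G] [BorelSpace G] in
/-- **Spatial plaquettes are carried along**: `p_{ij}(x) ∘ Θ = p_{ij}(θ_ℤ x)` for `0 < i < j`. [folklore] -/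
theorem torusPlaquette_timeReflect_spatial (r : LatticeRep G) (L : ℕ) {i j : Fin 4} (hi : 0 < i)
    (hij : i < j) (x : (Fin 4 → ℤ)) (U : GaugeConfig 4 L G) :
    torusPlaquette r L i j x U.timeReflect = torusPlaquette r L i j (thetaZ x) U := by
  rw [torusPlaquette_eq_plaqRe r L hij, torusPlaquette_eq_plaqRe r L hij,
    WilsonRP.plaqRe_timeReflect r.ρ r.continuous]
  simp only [WilsonRP.plaqReflect, hi.ne', ↓reduceIte, proj_thetaZ]

/-- The curvature species at `x` is the sum of its six torus plaquettes. [folklore] -/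
theorem torusDensity_eq_sum (r : LatticeRep G) (L : ℕ) (x : (Fin 4 → ℤ)) (U : GaugeConfig 4 L G) :
    torusDensity r L x U = ∑ i : Fin 4, ∑ j : Fin 4, if i < j then torusPlaquette r L i j x U else 0 := by
  unfold torusDensity
  have hcurv : r.curvature.F = actionDensity r.ρ := rfl
  rw [hcurv]
  unfold actionDensity
  refine Finset.sum_congr rfl fun i _ => Finset.sum_congr rfl fun j _ => ?_
  split_ifs
  · rw [CurvatureBoostCovariance.Negative.plaquetteObs_configShift_torusLift]
    unfold torusPlaquette plaquetteObs
    rw [CurvatureBoostCovariance.Negative.plaquetteHolonomyZd_torusLift']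
  · rfl

/-- The **reflected density** `P̃_y`: spatial plaquettes based at `y`, temporal plaquettes based at
`y − e₀` (hanging down from `y`). [folklore] -/
def reflDensity (r : LatticeRep G) (L : ℕ) (y : (Fin 4 → ℤ)) (U : GaugeConfig 4 L G) : ℝ :=
  ∑ i : Fin 4, ∑ j : Fin 4, if i < j then
    (if i = 0 then torusPlaquette r L 0 j (y - Pi.single 0 1) U else torusPlaquette r L i j y U) else 0

/-- **The lattice mirror of the curvature is the reflected density at the reflected site**:
`P_x ∘ Θ = P̃_{θ_ℤ x}` — not a translate of `P`. [folklore] -/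
theorem torusDensity_timeReflect (r : LatticeRep G) (L : ℕ) (x : (Fin 4 → ℤ)) (U : GaugeConfig 4 L G) :
    torusDensity r L x U.timeReflect = reflDensity r L (thetaZ x) U := by
  rw [torusDensity_eq_sum]
  unfold reflDensity
  refine Finset.sum_congr rfl fun i _ => Finset.sum_congr rfl fun j _ => ?_
  by_cases hij : i < j
  · simp only [hij, ↓reduceIte]
    by_cases hi : i = 0
    · subst hi
      simp only [↓reduceIte]
      exact torusPlaquette_timeReflect_temporal r L hij x U
    · simp only [hi, ↓reduceIte]
      exact torusPlaquette_timeReflect_spatial r L (Nat.pos_of_ne_zero (fun h => hi (Fin.ext h))) hij x U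
  · simp [hij]

/-- **The Θ-swap**: `P̃_y − P_y = −∑_{j>0} (E_j(y) − E_j(y − e₀))` (minus the backward time-difference
of the electric part). [folklore] -/
theorem reflDensity_sub_torusDensity (r : LatticeRep G) (L : ℕ) (y : (Fin 4 → ℤ)) (U : GaugeConfig 4 L G) :
    reflDensity r L y U - torusDensity r L y U =
      -∑ j : Fin 4, if 0 < j then
        (torusPlaquette r L 0 j y U - torusPlaquette r L 0 j (y - Pi.single 0 1) U) else 0 := by
  rw [torusDensity_eq_sum]
  unfold reflDensity
  rw [← Finset.sum_sub_distrib, Fin.sum_univ_four, Fin.sum_univ_four, Fin.sum_univ_four,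
    Fin.sum_univ_four, Fin.sum_univ_four, Fin.sum_univ_four]
  simp only [Fin.sum_univ_four, Fin.isValue, Fin.zero_lt_one, ↓reduceIte, lt_self_iff_false,
    Fin.reduceLT, Fin.reduceEq]
  ring

/-- **The smeared swap**: on a finite `e₀`-invariant index set, `∑ w(y)(P̃_y − P_y)` is the electric
part smeared against the FORWARD difference of `w` — one lattice spacing of a derivative. [folklore] -/
theorem sum_mul_reflDensity_sub (r : LatticeRep G) (L : ℕ) (U : GaugeConfig 4 L G) (Λ : Finset (Fin 4 → ℤ))
    (hΛ : ∀ y, y ∈ Λ ↔ y + Pi.single 0 1 ∈ Λ) (w : (Fin 4 → ℤ) → ℝ) :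
    ∑ y ∈ Λ, w y * (reflDensity r L y U - torusDensity r L y U) =
      ∑ y ∈ Λ, (w (y + Pi.single 0 1) - w y) *
        ∑ j : Fin 4, if 0 < j then torusPlaquette r L 0 j y U else 0 := by
  simp_rw [reflDensity_sub_torusDensity]
  set E : (Fin 4 → ℤ) → ℝ := fun y => ∑ j : Fin 4, if 0 < j then torusPlaquette r L 0 j y U else 0 with hE
  have hsplit : ∀ y, (∑ j : Fin 4, if 0 < j then
      (torusPlaquette r L 0 j y U - torusPlaquette r L 0 j (y - Pi.single 0 1) U) else 0) =
      E y - E (y - Pi.single 0 1) := by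
    intro y
    simp only [hE, ← Finset.sum_sub_distrib]
    refine Finset.sum_congr rfl fun j _ => ?_
    split_ifs <;> simp
  simp_rw [hsplit]
  have hre : ∑ y ∈ Λ, w y * E (y - Pi.single 0 1) = ∑ y ∈ Λ, w (y + Pi.single 0 1) * E y := by
    refine Finset.sum_nbij' (fun y => y - Pi.single 0 1) (fun y => y + Pi.single 0 1) ?_ ?_ ?_ ?_ ?_
    · intro y hy
      exact (hΛ (y - Pi.single 0 1)).2 (by simpa using hy)
    · intro y hy
      exact (hΛ y).1 hy
    · intro y _; simp
    · intro y _; simp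
    · intro y _; simp
  calc ∑ y ∈ Λ, w y * -(E y - E (y - Pi.single 0 1))
      = ∑ y ∈ Λ, w y * E (y - Pi.single 0 1) - ∑ y ∈ Λ, w y * E y := by
        rw [← Finset.sum_sub_distrib]; refine Finset.sum_congr rfl fun y _ => by ring
    _ = ∑ y ∈ Λ, w (y + Pi.single 0 1) * E y - ∑ y ∈ Λ, w y * E y := by rw [hre]
    _ = ∑ y ∈ Λ, (w (y + Pi.single 0 1) - w y) * E y := by
        rw [← Finset.sum_sub_distrib]; refine Finset.sum_congr rfl fun y _ => by ring

end ReflectedDensity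

/-! ### The plaquette RP square of the picked line is an Osterwalder–Seiler square -/

section RPSquare

variable {G : Type} [Group G] [TopologicalSpace G] [IsTopologicalGroup G] [CompactSpace G]
  [MeasurableSpace G] [BorelSpace G]

/-- VERBATIM `ConditionalMeanTelescoping.rpSquare`: `A(β,S,R) = ⟨θX·X⟩`, `X = δp₀₁(R e₀)`. [folklore] -/
def rpSquare (r : LatticeRep G) (β : ℝ) (S R : ℕ) : ℝ :=
  let μ := wilsonMeasure (d := 4) (L := 2 * S + 1) r.ρ β
  let X : GaugeConfig 4 (2 * S + 1) G → ℝ :=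
    fun U => torusPlaquette r (2 * S + 1) 0 1 (Pi.single 0 (R : ℤ)) U -
      ∫ V, torusPlaquette r (2 * S + 1) 0 1 (Pi.single 0 (R : ℤ)) V ∂μ
  ∫ U, X (GaugeConfig.timeReflect U) * X U ∂μ

omit [IsTopologicalGroup G] [CompactSpace G] [BorelSpace G] in
/-- The centred torus plaquette is bounded by `2N`. [folklore] -/
theorem abs_centred_torusPlaquette_le (r : LatticeRep G) (L : ℕ) (i j : Fin 4) (x : (Fin 4 → ℤ))
    (μ : Measure (GaugeConfig 4 L G)) [IsProbabilityMeasure μ] (U : GaugeConfig 4 L G) :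
    |torusPlaquette r L i j x U - ∫ V, torusPlaquette r L i j x V ∂μ| ≤ 2 * r.N := by
  have hb : ∀ V, |torusPlaquette r L i j x V| ≤ r.N := fun V =>
    abs_plaquetteObs_le_holds (ρ := r.ρ) r.mem_unitary x i j _
  have hint : |∫ V, torusPlaquette r L i j x V ∂μ| ≤ r.N := by
    refine (abs_integral_le_integral_abs).trans ?_
    calc ∫ V, |torusPlaquette r L i j x V| ∂μ ≤ ∫ _, (r.N : ℝ) ∂μ :=
          integral_mono_of_nonneg (Eventually.of_forall fun _ => abs_nonneg _) (integrable_const _)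
            (Eventually.of_forall hb)
      _ = r.N := by simp
  calc |torusPlaquette r L i j x U - ∫ V, torusPlaquette r L i j x V ∂μ|
      ≤ |torusPlaquette r L i j x U| + |∫ V, torusPlaquette r L i j x V ∂μ| := abs_sub _ _
    _ ≤ r.N + r.N := add_le_add (hb U) hint
    _ = 2 * r.N := by ring

/-- The torus plaquette is measurable. [folklore] -/
theorem measurable_torusPlaquette (r : LatticeRep G) (L : ℕ) (i j : Fin 4) (x : (Fin 4 → ℤ)) :
    Measurable (torusPlaquette r L i j x) := by
  haveI : SecondCountableTopology G :=
    (r.continuous.isClosedEmbedding r.injective).isEmbedding.secondCountableTopology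
  exact (measurable_plaquetteObs r.ρ r.continuous x i j).comp
    (measurable_pi_lambda _ fun _ => measurable_pi_apply _)

omit [IsTopologicalGroup G] [CompactSpace G] [MeasurableSpace G] [BorelSpace G] in
/-- A torus plaquette depends only on its four torus links. [folklore] -/
theorem dependsOn_torusPlaquette (r : LatticeRep G) (L : ℕ) (i j : Fin 4) (x : (Fin 4 → ℤ)) :
    DependsOn (torusPlaquette r L i j x)
      {torusEdge L (x, i), torusEdge L (x + Pi.single i 1, j), torusEdge L (x + Pi.single j 1, i),
        torusEdge L (x, j)} := by
  intro U V h
  unfold torusPlaquette plaquetteObs plaquetteHolonomyZd torusLift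
  simp only [Function.comp_apply]
  rw [h _ (by simp), h (torusEdge L (x + Pi.single i 1, j)) (by simp),
    h (torusEdge L (x + Pi.single j 1, i)) (by simp), h (torusEdge L (x, j)) (by simp)]

omit [Group G] [TopologicalSpace G] [IsTopologicalGroup G] [CompactSpace G] [MeasurableSpace G]
  [BorelSpace G] in
/-- Time coordinate of a projected site with small non-negative time. [folklore] -/
theorem val_proj_zero {S : ℕ} {x : (Fin 4 → ℤ)} {t : ℕ} (hx : x 0 = t) (ht : t < 2 * S + 1) :
    (Torus.proj (2 * S + 1) x 0).val = t := by
  simp only [Torus.proj, hx, Int.cast_natCast, ZMod.val_natCast]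
  exact Nat.mod_eq_of_lt ht

omit [Group G] [TopologicalSpace G] [IsTopologicalGroup G] [CompactSpace G] [MeasurableSpace G]
  [BorelSpace G] in
/-- **The four links of `p₀₁(R e₀)` lie in `P ∪ M`** (`1 ≤ R ≤ S`). [folklore] -/
theorem plaquette_edges_subset_pos_union_shared {S R : ℕ} (hR : 1 ≤ R) (hRS : R ≤ S) :
    ({torusEdge (2 * S + 1) ((Pi.single 0 (R : ℤ) : (Fin 4 → ℤ)), (0 : Fin 4)),
      torusEdge (2 * S + 1) ((Pi.single 0 (R : ℤ) : (Fin 4 → ℤ)) + Pi.single (0 : Fin 4) 1, (1 : Fin 4)),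
      torusEdge (2 * S + 1) ((Pi.single 0 (R : ℤ) : (Fin 4 → ℤ)) + Pi.single (1 : Fin 4) 1, (0 : Fin 4)),
      torusEdge (2 * S + 1) ((Pi.single 0 (R : ℤ) : (Fin 4 → ℤ)), (1 : Fin 4))} : Set (Edge 4 (2 * S + 1))) ⊆
      ((WilsonOddRP.oPosEdges ∪ WilsonOddRP.oSharedEdges : Finset (Edge 4 (2 * S + 1))) :
        Set (Edge 4 (2 * S + 1))) := by
  haveI : Fact (1 < 2 * S + 1) := ⟨by omega⟩
  have hL2 : (2 * S + 1) / 2 = S := by omega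
  have hR' : (Torus.proj (2 * S + 1) (Pi.single 0 (R : ℤ) : (Fin 4 → ℤ)) 0).val = R :=
    val_proj_zero (by simp) (by omega)
  have hR1 : (Torus.proj (2 * S + 1) ((Pi.single 0 (R : ℤ) : (Fin 4 → ℤ)) + Pi.single (1 : Fin 4) 1) 0).val = R :=
    val_proj_zero (by simp) (by omega)
  have hR0 : (Torus.proj (2 * S + 1) ((Pi.single 0 (R : ℤ) : (Fin 4 → ℤ)) + Pi.single (0 : Fin 4) 1) 0).val =
      R + 1 :=
    val_proj_zero (t := R + 1) (by simp) (by omega)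
  intro e he
  simp only [Set.mem_insert_iff, Set.mem_singleton_iff] at he
  rw [Finset.coe_union, Set.mem_union, Finset.mem_coe, Finset.mem_coe, WilsonOddRP.mem_oPosEdges,
    WilsonOddRP.mem_oSharedEdges, WilsonOddRP.IsOPosEdge, WilsonOddRP.IsOSharedEdge, hL2]
  rcases he with rfl | rfl | rfl | rfl
  · left; simp only [torusEdge]; rw [hR']; exact ⟨hR, hRS⟩
  · simp only [torusEdge]
    rw [hR0]
    rcases Nat.lt_or_ge R S with h | h
    · left; exact ⟨by omega, h⟩
    · right; exact ⟨one_ne_zero, by omega⟩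
  · left; simp only [torusEdge]; rw [hR1]; exact ⟨hR, hRS⟩
  · left; simp only [torusEdge]; rw [hR']; exact ⟨hR, hRS⟩

/-- **`rpSquare` is non-negative** for `β ≥ 0`, `1 ≤ R ≤ S`: an Osterwalder–Seiler square on the odd
torus. [folklore] -/
theorem rpSquare_nonneg (r : LatticeRep G) {β : ℝ} (hβ : 0 ≤ β) {S R : ℕ} (hR : 1 ≤ R)
    (hRS : R ≤ S) : 0 ≤ rpSquare r β S R := by
  haveI := isProbabilityMeasure_wilsonMeasure (d := 4) (L := 2 * S + 1) r.ρ r.continuous β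
  haveI : Fact (1 < 2 * S + 1) := ⟨by omega⟩
  set μ := wilsonMeasure (d := 4) (L := 2 * S + 1) r.ρ β with hμ
  set X : GaugeConfig 4 (2 * S + 1) G → ℝ := fun U =>
    torusPlaquette r (2 * S + 1) 0 1 (Pi.single 0 (R : ℤ)) U -
      ∫ V, torusPlaquette r (2 * S + 1) 0 1 (Pi.single 0 (R : ℤ)) V ∂μ with hX
  have hXm : Measurable X := (measurable_torusPlaquette r _ 0 1 _).sub measurable_const
  have hXb : ∀ U, |X U| ≤ 2 * r.N := fun U => abs_centred_torusPlaquette_le r _ 0 1 _ μ U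
  have hXdep : DependsOn X
      ((WilsonOddRP.oPosEdges ∪ WilsonOddRP.oSharedEdges : Finset (Edge 4 (2 * S + 1))) :
        Set (Edge 4 (2 * S + 1))) := by
    refine DependsOn.mono (plaquette_edges_subset_pos_union_shared hR hRS) ?_
    intro U V h
    simp only [hX]
    rw [dependsOn_torusPlaquette r (2 * S + 1) 0 1 (Pi.single 0 (R : ℤ)) h]
  set F : GaugeConfig 4 (2 * S + 1) G → ℂ := fun U => (X U : ℂ) with hF
  have hpos := wilsonExpectation_oddReflectionPositive (d := 4) (L := 2 * S + 1) r.ρ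
    (by exact ⟨S, by ring⟩) (by omega) r.continuous hβ F (Complex.measurable_ofReal.comp hXm)
    ⟨2 * r.N, fun U => by
      rw [hF, Complex.norm_real, Real.norm_eq_abs]; exact hXb U⟩
    (fun U V h => by simp only [hF, hXdep h])
  have hint : wilsonExpectation (d := 4) (L := 2 * S + 1) r.ρ β
      (fun U => conj (F U.timeReflect) * F U) = ((rpSquare r β S R : ℝ) : ℂ) := by
    simp only [wilsonExpectation, hF, Complex.conj_ofReal, ← Complex.ofReal_mul]
    rw [integral_complex_ofReal]
    rfl
  rw [hint] at hpos
  exact_mod_cast hpos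

end RPSquare

end Summit.QuantumFields.YangMills.Theorems.HypercubicLimit.Negative

end
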